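import Literature.MathematicalPhysics.QuantumFieldTheory.CurvatureGaussianField
import HarnessLib

/-!
# Stub `stub_kernelClosed` of line `Sketch` (crux `stmt-QuantumFields-8760`)

Route `EquipartitionCriticality` of `YangMills`, crux item `stmt-QuantumFields-8760`
(`Summit.QuantumFields.YangMills.Theses.EquipartitionCriticality.EquipartitionPinsProbe`), line
`Sketch`, STUB K2 of the lead's skeleton.

What is proved: the two-plaquette kernel `T(p, q) = curvatureTwoPoint p q` of the lattice Maxwell
(curvature) Gaussian field on `ℤ⁴` is closed in its first slot: for every plaquette `q` and every
`3`-cell `(x; i < j < k)`, the cube coboundary of the `2`-cochain `Y := T(·, q)`,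
`∂ᵢ Y_{jk} − ∂ⱼ Y_{ik} + ∂ₖ Y_{ij}` (`∂ᵢ` the forward difference along `eᵢ`), vanishes at `x`.

Proof: by `curvatureTwoPoint_eq_plaquetteCurl`, `Y = dA` for the `1`-cochain
`A e := plaquetteCurl (fun f => edgeGreen e f) q`, and `d ∘ d = 0` on the cubic lattice
(`KernelClosed.cube_coboundary_plaquetteCurl`, valid for every `1`-cochain `A` in every dimension
`d`): expanding the six curls with `plaquetteCurl_eq` and aligning `x + eᵢ + eⱼ = x + eⱼ + eᵢ`,
the twenty-four edge terms cancel in pairs. No property of `edgeGreen` is used.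
-/

noncomputable section

open Literature.MathematicalPhysics.QuantumFieldTheory Literature.MathematicalPhysics.QuantumLattice
  Literature.Probability.LatticeModels

namespace Summit.QuantumFields.YangMills.Theorems.EquipartitionPinsProbe

namespace KernelClosed

/-- **`d ∘ d = 0` from `1`-cochains to `3`-cochains of `ℤ^d`.** For every `1`-cochain `A` and
every `3`-cell `(x; i < j < k)`, the cube coboundary
`∂ᵢ (dA)_{jk} − ∂ⱼ (dA)_{ik} + ∂ₖ (dA)_{ij}` of the curl `dA = plaquetteCurl A` vanishes at `x`
(`∂ᵢ` the forward difference along `eᵢ`). -/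
theorem cube_coboundary_plaquetteCurl {d : ℕ} (A : ZdEdge d → ℝ) (x : Site d) (i j k : Fin d)
    (hij : i < j) (hjk : j < k) :
    (plaquetteCurl A (x + Pi.single i 1, ⟨(j, k), hjk⟩) - plaquetteCurl A (x, ⟨(j, k), hjk⟩)) -
        (plaquetteCurl A (x + Pi.single j 1, ⟨(i, k), hij.trans hjk⟩) -
          plaquetteCurl A (x, ⟨(i, k), hij.trans hjk⟩)) +
        (plaquetteCurl A (x + Pi.single k 1, ⟨(i, j), hij⟩) - plaquetteCurl A (x, ⟨(i, j), hij⟩)) =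
      0 := by
  simp only [plaquetteCurl_eq, add_right_comm x (Pi.single j 1) (Pi.single i 1),
    add_right_comm x (Pi.single k 1) (Pi.single i 1), add_right_comm x (Pi.single k 1) (Pi.single j 1)]
  ring

end KernelClosed

/-- STUB K2 — **the curvature kernel is closed in each slot** (`d T = 0`): for every `3`-cell
`(x; i < j < k)` of `ℤ⁴` and every plaquette `q`,
`∂ᵢ T((·; j, k), q) − ∂ⱼ T((·; i, k), q) + ∂ₖ T((·; i, j), q) = 0` at `x`, where
`T = curvatureTwoPoint` (`T(·, q) = d(…)` by `curvatureTwoPoint_eq_plaquetteCurl`, and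
`d ∘ d = 0`, `KernelClosed.cube_coboundary_plaquetteCurl`). -/
theorem stub_kernelClosed :
    ∀ (q : Literature.MathematicalPhysics.QuantumLattice.ZdPlaquette 4)
      (x : Literature.Probability.LatticeModels.Site 4) (i j k : Fin 4) (hij : i < j) (hjk : j < k),
      (Literature.MathematicalPhysics.QuantumFieldTheory.curvatureTwoPoint
            (x + Pi.single i 1, ⟨(j, k), hjk⟩) q -
          Literature.MathematicalPhysics.QuantumFieldTheory.curvatureTwoPoint (x, ⟨(j, k), hjk⟩) q) -
        (Literature.MathematicalPhysics.QuantumFieldTheory.curvatureTwoPoint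
            (x + Pi.single j 1, ⟨(i, k), hij.trans hjk⟩) q -
          Literature.MathematicalPhysics.QuantumFieldTheory.curvatureTwoPoint
            (x, ⟨(i, k), hij.trans hjk⟩) q) +
        (Literature.MathematicalPhysics.QuantumFieldTheory.curvatureTwoPoint
            (x + Pi.single k 1, ⟨(i, j), hij⟩) q -
          Literature.MathematicalPhysics.QuantumFieldTheory.curvatureTwoPoint (x, ⟨(i, j), hij⟩) q) =
      0 := by
  intro q x i j k hij hjk
  simp only [curvatureTwoPoint_eq_plaquetteCurl]
  exact KernelClosed.cube_coboundary_plaquetteCurl _ x i j k hij hjk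

end Summit.QuantumFields.YangMills.Theorems.EquipartitionPinsProbe

end
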